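import Literature.Geometry.Lorentzian.KerrRadiusGradientVector
import Literature.Geometry.Lorentzian.KerrSchildTimeTranslation
import Literature.Geometry.Lorentzian.KerrCylinderVacuum
import Summits.FinalStateConjecture.FinalStateConjecture.Theorems.BartnikGapSettlingGapExhaustionCylindersBendInwardOf
import HarnessLib

/-!
# Crux `GapExhaustion` (stmt-FinalStateConjecture-10808), line `photon-shell-pseudoconvexity`:
# stub (E-1b, §1f ESCAPE) `stub_kerrEscapeFieldsContinuous` — continuous exact-Kerr escape fields

Route `BartnikGapSettling`; helper (`--supports stmt-FinalStateConjecture-10808`) landing the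
registered sub-stub (E-1b) of the orientation-free escape step §1f ("every point of a near-Kerr
chart with `r ≥ r₊ + η` lies in the chronological past of the far zone"), the variant of (E-1)
(`stub_kerrEscapeFields`, module `…KerrEscapeFields`) with CONTINUITY of the two fields on the
exterior `{r > r₊}` added (used by the lead to propagate the time-orientation class along the
escape chain): **in exact Kerr, Kerr–Schild Cartesian coordinates (`Kerr.bilin M a = η + 2H ℓ ⊗ ℓ`),
on every radial band `r₊ < r_lo ≤ r ≤ r_hi` (all Kerr-star times, axis included) there are two
bounded vector fields `Y₁, Y₂`, continuous on `{r > r₊}`, timelike with a uniform margin, lying in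
OPPOSITE time-cones (`g(Y₁, Y₂) ≥ m > 0`), both increasing the Kerr–Schild radius at a uniform
rate (`dr(Yᵢ) ≥ ν > 0`).** (The helpers of (E-1) are private to its module, so the construction is
re-run here.)

Witnesses (`V = Kerr.timeVector = −g♯dt*`, `W = Kerr.radiusGradVector = g♯dr`, `H = Mr/Σ`,
`Δ = r² − 2Mr + a² > 0` beyond `r₊`):

* `Y₂ = −V` (past-pointing for Kerr's own orientation, in the INGOING chart it moves outward):
  `g(Y₂, Y₂) = −1 − 2H ≤ −1`, `dr(Y₂) = −g(W, V) = 2H > 0`;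
* `Y₁ = V + (4Mr/Δ) W` (future-pointing and outgoing): with `g(V, W) = −2H`, `g(W, W) = Δ/Σ` and
  `HΣ = Mr` one gets `g(Y₁, Y₁) = −1 − 2H ≤ −1`, `g(Y₁, Y₂) = 1 + 2H + 8MrH/Δ ≥ 1`,
  `dr(Y₁) = −2H + 4Mr/Σ = 2H > 0`.

So `m = 1`; the rate `ν = inf 2H > 0` and the bound `L = sup ‖Yᵢ‖` over the band come from the
compact time slice `{z⁰ = 0, r_lo ≤ r ≤ r_hi}` (`kerrCylindersBendInward_isCompact_slice`) and the
stationarity of Kerr (`Kerr.scalarH_add_smul_basisVector_zero`,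
`Kerr.timeVector_add_smul_basisVector_zero`, `Kerr.radius_add_time_smul_basisVector`). Both fields
are continuous on `{r > r₊}`: `V`, `g♯dr`, `r` are continuous on `{r > 0}` and `Δ > 0` beyond `r₊`.
O'Neill 1995, §2.4–§2.5 (`Δ`, `grad r`); Dafermos–Rodnianski arXiv:0811.0354, §5.1 (`V`).
-/

noncomputable section

-- D-0017: single-problem summit, `Summit.<S>.<S>.…` by design (cf. lakefile `weak.linter.dupNamespace`).
set_option linter.dupNamespace false

namespace Summit.FinalStateConjecture.FinalStateConjecture.Theorems

open Set Literature.Geometry.Lorentzian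
open scoped Manifold ContDiff Topology ENNReal

/-! ### Generic: uniform constants on a band from the compact time slice and stationarity -/

/-- A stationary real function, continuous and positive at the points of a Kerr–Schild radial
band `r_lo ≤ r ≤ r_hi` (`r_lo > 0`), has a positive lower bound on the band: minimum over the
compact time slice `{z⁰ = 0}` of the band, transported to all times. [folklore] -/
private theorem kerrEscapeCont_exists_pos_le {a r_lo r_hi : ℝ} (hlo0 : 0 < r_lo) {f : E4 → ℝ}
    (hf : ∀ z, r_lo ≤ Kerr.radius a z → Kerr.radius a z ≤ r_hi → ContinuousAt f z)
    (hst : ∀ (z : E4) (t : ℝ), f (z + t • E4.basisVector 0) = f z)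
    (hpos : ∀ z, r_lo ≤ Kerr.radius a z → Kerr.radius a z ≤ r_hi → 0 < f z) :
    ∃ ν : ℝ, 0 < ν ∧ ∀ z, r_lo ≤ Kerr.radius a z → Kerr.radius a z ≤ r_hi → ν ≤ f z := by
  set S : Set E4 := {z : E4 | z 0 = 0 ∧ r_lo ≤ Kerr.radius a z ∧ Kerr.radius a z ≤ r_hi} with hS
  have hSc : IsCompact S := kerrCylindersBendInward_isCompact_slice a r_hi hlo0
  have hfc : ContinuousOn f S := fun z hz ↦ (hf z hz.2.1 hz.2.2).continuousWithinAt
  obtain ⟨ν, hν, hνS⟩ : ∃ ν : ℝ, 0 < ν ∧ ∀ z ∈ S, ν ≤ f z := by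
    rcases S.eq_empty_or_nonempty with hSe | hne
    · exact ⟨1, one_pos, fun z hz ↦ by simp [hSe] at hz⟩
    · obtain ⟨z₀, hz₀, hmin⟩ := hSc.exists_isMinOn hne hfc
      exact ⟨f z₀, hpos z₀ hz₀.2.1 hz₀.2.2, fun z hz ↦ hmin hz⟩
  refine ⟨ν, hν, fun z hz₁ hz₂ ↦ ?_⟩
  have hrad : Kerr.radius a (z + (-z 0) • E4.basisVector 0) = Kerr.radius a z :=
    Kerr.radius_add_time_smul_basisVector a z _
  have hmem : z + (-z 0) • E4.basisVector 0 ∈ S :=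
    ⟨by simp [E4.basisVector], hrad ▸ hz₁, hrad ▸ hz₂⟩
  have h := hνS _ hmem
  rwa [hst] at h

/-- A stationary vector-valued function, continuous at the points of a Kerr–Schild radial band
`r_lo ≤ r ≤ r_hi` (`r_lo > 0`), is bounded on the band: bound over the compact time slice
`{z⁰ = 0}` of the band, transported to all times. [folklore] -/
private theorem kerrEscapeCont_exists_norm_le {a r_lo r_hi : ℝ} (hlo0 : 0 < r_lo) {F : E4 → E4}
    (hF : ∀ z, r_lo ≤ Kerr.radius a z → Kerr.radius a z ≤ r_hi → ContinuousAt F z)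
    (hst : ∀ (z : E4) (t : ℝ), F (z + t • E4.basisVector 0) = F z) :
    ∃ L : ℝ, 0 < L ∧ ∀ z, r_lo ≤ Kerr.radius a z → Kerr.radius a z ≤ r_hi → ‖F z‖ ≤ L := by
  set S : Set E4 := {z : E4 | z 0 = 0 ∧ r_lo ≤ Kerr.radius a z ∧ Kerr.radius a z ≤ r_hi} with hS
  have hSc : IsCompact S := kerrCylindersBendInward_isCompact_slice a r_hi hlo0
  have hFc : ContinuousOn F S := fun z hz ↦ (hF z hz.2.1 hz.2.2).continuousWithinAt
  obtain ⟨B, hB⟩ := hSc.exists_bound_of_continuousOn hFc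
  refine ⟨max B 1, lt_max_of_lt_right one_pos, fun z hz₁ hz₂ ↦ ?_⟩
  have hrad : Kerr.radius a (z + (-z 0) • E4.basisVector 0) = Kerr.radius a z :=
    Kerr.radius_add_time_smul_basisVector a z _
  have hmem : z + (-z 0) • E4.basisVector 0 ∈ S :=
    ⟨by simp [E4.basisVector], hrad ▸ hz₁, hrad ▸ hz₂⟩
  have h := hB _ hmem
  rw [hst] at h
  exact h.trans (le_max_left _ _)

/-! ### The Kerr ingredients: `W = g♯dr` is stationary and continuous, `Δ > 0` on the band -/

/-- `g♯dr` is invariant under Kerr-star time translations (Kerr is stationary).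
[cite: ONeill1995, §2.5] -/
private theorem kerrEscapeCont_radiusGradVector_add_time (M a : ℝ) (z : E4) (t : ℝ) :
    Kerr.radiusGradVector M a (z + t • E4.basisVector 0) = Kerr.radiusGradVector M a z := by
  simp only [Kerr.radiusGradVector, Kerr.spatial_add_smul_basisVector_zero,
    Kerr.scalarH_add_smul_basisVector_zero, Kerr.nullVector_add_smul_basisVector_zero]

/-- `z ↦ g♯dr_z` is continuous wherever `r > 0` (it is the tree's `Kerr.radiusSharp`, which is
smooth there, `Kerr.contDiffAt_radiusSharp`). [folklore] -/
private theorem kerrEscapeCont_continuousAt_radiusGradVector (M a : ℝ) {z : E4}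
    (hz : 0 < Kerr.radius a z) : ContinuousAt (Kerr.radiusGradVector M a) z := by
  have h : Kerr.radiusSharp M a = Kerr.radiusGradVector M a := rfl
  rw [← h]
  exact (Kerr.contDiffAt_radiusSharp M hz (n := 0)).continuousAt

/-- `Δ(r) = r² − 2Mr + a² > 0` at points with `r > r₊` of a subextremal Kerr
(`Δ = (r − r₊)(r − r₋)`). [cite: ONeill1995, §2.4] -/
private theorem kerrEscapeCont_delta_pos {M a : ℝ} (ha : |a| < M) {z : E4}
    (hz : Kerr.rPlus M a < Kerr.radius a z) :
    0 < Kerr.radius a z ^ 2 - 2 * M * Kerr.radius a z + a ^ 2 := by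
  have hsub : Kerr.IsSubextremal M a := ha
  rw [← Kerr.sub_rPlus_mul_sub_rMinus hsub.sq_lt_sq.le]
  exact Kerr.sub_rPlus_mul_sub_rMinus_pos hz

/-- `H = Mr³/(r⁴ + a²z²) > 0` for `M > 0` wherever `r > 0` (the tree's `Kerr.scalarH_pos` of
`KerrLeafEnergyComparison.lean`, outside this file's import cone). [cite: arXiv07060622, (33)] -/
private theorem kerrEscapeCont_scalarH_pos {M a : ℝ} (hM : 0 < M) {z : E4} (hz : 0 < Kerr.radius a z) :
    0 < Kerr.scalarH M a z := by
  unfold Kerr.scalarH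
  positivity

/-! ### The pointwise identities for `Y₁ = V + (4Mr/Δ) W` and `Y₂ = −V` -/

/-- `g(−V, −V) = −1 − 2H`. [cite: arXiv08110354, §5.1] -/
private theorem kerrEscapeCont_bilin_Y₂_Y₂ {M a : ℝ} {z : E4} (hz : 0 < Kerr.radius a z) :
    Kerr.bilin M a z (-Kerr.timeVector M a z) (-Kerr.timeVector M a z) =
      -1 - 2 * Kerr.scalarH M a z := by
  simp only [map_neg, neg_apply, neg_neg]
  exact Kerr.bilin_timeVector_timeVector hz

/-- `dr(−V) = g(W, −V) = 2H`. [cite: ONeill1995, §2.5] -/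
private theorem kerrEscapeCont_dr_Y₂ {M a : ℝ} {z : E4} (hz : 0 < Kerr.radius a z) :
    fderiv ℝ (Kerr.radius a) z (-Kerr.timeVector M a z) = 2 * Kerr.scalarH M a z := by
  rw [(Kerr.hasFDerivAt_radius_bilin (M := M) hz).fderiv, map_neg, Kerr.bilin_symm,
    Kerr.bilin_timeVector_radiusGradVector hz, neg_neg]

/-- `g(Y₁, Y₁) = −1 − 2H` for `Y₁ = V + (4Mr/Δ) W` (`g(V,V) = −1 − 2H`, `g(V,W) = −2H`,
`g(W,W) = Δ/Σ`, `HΣ = Mr`). [cite: ONeill1995, §2.5] -/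
private theorem kerrEscapeCont_bilin_Y₁_Y₁ {M a : ℝ} {z : E4} (hz : 0 < Kerr.radius a z)
    (hΔ : Kerr.radius a z ^ 2 - 2 * M * Kerr.radius a z + a ^ 2 ≠ 0) :
    Kerr.bilin M a z
        (Kerr.timeVector M a z + (4 * M * Kerr.radius a z /
          (Kerr.radius a z ^ 2 - 2 * M * Kerr.radius a z + a ^ 2)) • Kerr.radiusGradVector M a z)
        (Kerr.timeVector M a z + (4 * M * Kerr.radius a z /
          (Kerr.radius a z ^ 2 - 2 * M * Kerr.radius a z + a ^ 2)) • Kerr.radiusGradVector M a z) =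
      -1 - 2 * Kerr.scalarH M a z := by
  have hS : 0 < Kerr.blSigma a (E4.spatial z) := Kerr.blSigma_spatial_pos hz
  simp only [map_add, map_smul, add_apply, smul_apply, smul_eq_mul]
  rw [Kerr.bilin_timeVector_timeVector hz, Kerr.bilin_timeVector_radiusGradVector hz,
    Kerr.bilin_symm M a z (Kerr.radiusGradVector M a z) (Kerr.timeVector M a z),
    Kerr.bilin_timeVector_radiusGradVector hz, Kerr.bilin_radiusGradVector_self hz,
    Kerr.scalarH_eq_div_blSigma M a hz]
  -- `Δ` as an independent atom: the identity holds for rational functions of `(M, r, Σ, Δ)`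
  generalize Kerr.radius a z ^ 2 - 2 * M * Kerr.radius a z + a ^ 2 = D at hΔ ⊢
  field_simp
  ring

/-- `g(Y₁, −V) = 1 + 2H + (4Mr/Δ)(2H)` for `Y₁ = V + (4Mr/Δ) W`. [cite: ONeill1995, §2.5] -/
private theorem kerrEscapeCont_bilin_Y₁_Y₂ {M a : ℝ} {z : E4} (hz : 0 < Kerr.radius a z) :
    Kerr.bilin M a z
        (Kerr.timeVector M a z + (4 * M * Kerr.radius a z /
          (Kerr.radius a z ^ 2 - 2 * M * Kerr.radius a z + a ^ 2)) • Kerr.radiusGradVector M a z)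
        (-Kerr.timeVector M a z) =
      1 + 2 * Kerr.scalarH M a z + (4 * M * Kerr.radius a z /
          (Kerr.radius a z ^ 2 - 2 * M * Kerr.radius a z + a ^ 2)) * (2 * Kerr.scalarH M a z) := by
  simp only [map_add, map_smul, map_neg, add_apply, smul_apply, smul_eq_mul]
  rw [Kerr.bilin_timeVector_timeVector hz,
    Kerr.bilin_symm M a z (Kerr.radiusGradVector M a z) (Kerr.timeVector M a z),
    Kerr.bilin_timeVector_radiusGradVector hz]
  ring

/-- `dr(Y₁) = g(W, V) + (4Mr/Δ) g(W, W) = −2H + 4Mr/Σ = 2H` for `Y₁ = V + (4Mr/Δ) W`.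
[cite: ONeill1995, §2.5] -/
private theorem kerrEscapeCont_dr_Y₁ {M a : ℝ} {z : E4} (hz : 0 < Kerr.radius a z)
    (hΔ : Kerr.radius a z ^ 2 - 2 * M * Kerr.radius a z + a ^ 2 ≠ 0) :
    fderiv ℝ (Kerr.radius a) z
        (Kerr.timeVector M a z + (4 * M * Kerr.radius a z /
          (Kerr.radius a z ^ 2 - 2 * M * Kerr.radius a z + a ^ 2)) • Kerr.radiusGradVector M a z) =
      2 * Kerr.scalarH M a z := by
  have hS : 0 < Kerr.blSigma a (E4.spatial z) := Kerr.blSigma_spatial_pos hz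
  rw [(Kerr.hasFDerivAt_radius_bilin (M := M) hz).fderiv, map_add, map_smul, smul_eq_mul,
    Kerr.bilin_symm M a z (Kerr.radiusGradVector M a z) (Kerr.timeVector M a z),
    Kerr.bilin_timeVector_radiusGradVector hz, Kerr.bilin_radiusGradVector_self hz,
    Kerr.scalarH_eq_div_blSigma M a hz]
  generalize Kerr.radius a z ^ 2 - 2 * M * Kerr.radius a z + a ^ 2 = D at hΔ ⊢
  field_simp
  ring

/-- **Stub (E-1b) of §1f ESCAPE (crux `GapExhaustion`, stmt-FinalStateConjecture-10808; line
photon-shell-pseudoconvexity) — continuous exact-Kerr escape fields.** For `0 < M`, `|a| < M` and a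
radial band `r₊ < r_lo ≤ r_hi` of Kerr–Schild coordinate space there are constants `m, ν, L > 0`
and two vector fields `Y₁, Y₂`, continuous on the exterior `{r > r₊}`, such that at every point `z`
with `r_lo ≤ r(z) ≤ r_hi` (all times): `‖Yᵢ z‖ ≤ L`, `g_z(Yᵢ, Yᵢ) ≤ −m` (timelike with margin),
`g_z(Y₁, Y₂) ≥ m` (opposite time-cones) and `dr_z(Yᵢ) ≥ ν` (both increase the radius). Witnesses
`Y₂ = −V`, `Y₁ = V + (4Mr/Δ) g♯dr` with `V = −g♯dt*` (Dafermos–Rodnianski arXiv:0811.0354, §5.1;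
O'Neill 1995, §2.5), `m = 1`, `ν = inf_band 2H`, `L = sup_band ‖Yᵢ‖` (compact time slice +
stationarity). -/
theorem stub_kerrEscapeFieldsContinuous :
    ∀ (M a r_lo r_hi : ℝ), 0 < M → |a| < M → Kerr.rPlus M a < r_lo → r_lo ≤ r_hi →
      ∃ (m ν L : ℝ), 0 < m ∧ 0 < ν ∧ 0 < L ∧
      ∃ (Y₁ Y₂ : E4 → E4),
        ContinuousOn Y₁ {z : E4 | Kerr.rPlus M a < Kerr.radius a z} ∧
        ContinuousOn Y₂ {z : E4 | Kerr.rPlus M a < Kerr.radius a z} ∧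
        ∀ z : E4, r_lo ≤ Kerr.radius a z → Kerr.radius a z ≤ r_hi →
          ‖Y₁ z‖ ≤ L ∧ ‖Y₂ z‖ ≤ L ∧
          Kerr.bilin M a z (Y₁ z) (Y₁ z) ≤ -m ∧ Kerr.bilin M a z (Y₂ z) (Y₂ z) ≤ -m ∧
          m ≤ Kerr.bilin M a z (Y₁ z) (Y₂ z) ∧
          ν ≤ fderiv ℝ (Kerr.radius a) z (Y₁ z) ∧ ν ≤ fderiv ℝ (Kerr.radius a) z (Y₂ z) := by
  intro M a r_lo r_hi hM ha hlo _hlohi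
  have hsub : Kerr.IsSubextremal M a := ha
  have hlo0 : 0 < r_lo := hsub.rPlus_pos.trans hlo
  -- abbreviations: `Δ`, the coefficient `4Mr/Δ`, the two fields
  set Δ : E4 → ℝ := fun z ↦ Kerr.radius a z ^ 2 - 2 * M * Kerr.radius a z + a ^ 2 with hΔdef
  set Y₁ : E4 → E4 := fun z ↦ Kerr.timeVector M a z +
    (4 * M * Kerr.radius a z / Δ z) • Kerr.radiusGradVector M a z with hY₁def
  set Y₂ : E4 → E4 := fun z ↦ -Kerr.timeVector M a z with hY₂def
  -- on the exterior / the band: `r > 0`, `Δ > 0`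
  have hext0 : ∀ z, Kerr.rPlus M a < Kerr.radius a z → 0 < Kerr.radius a z := fun z hz ↦
    hsub.rPlus_pos.trans hz
  have hext : ∀ z, r_lo ≤ Kerr.radius a z → Kerr.rPlus M a < Kerr.radius a z := fun z hz ↦
    hlo.trans_le hz
  have hpos : ∀ z, r_lo ≤ Kerr.radius a z → 0 < Kerr.radius a z := fun z hz ↦ hlo0.trans_le hz
  have hΔpos : ∀ z, Kerr.rPlus M a < Kerr.radius a z → 0 < Δ z := fun z hz ↦
    kerrEscapeCont_delta_pos ha hz
  -- continuity of the two fields at exterior points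
  have hY₁c : ∀ z, Kerr.rPlus M a < Kerr.radius a z → ContinuousAt Y₁ z := by
    intro z hzext
    have hz := hext0 z hzext
    have hc : ContinuousAt (fun z ↦ 4 * M * Kerr.radius a z / Δ z) z :=
      (continuousAt_const.mul (Kerr.continuous_radius a).continuousAt).div
        ((((Kerr.continuous_radius a).continuousAt.pow 2).sub
          (continuousAt_const.mul (Kerr.continuous_radius a).continuousAt)).add
          continuousAt_const) (hΔpos z hzext).ne'
    exact (Kerr.contDiffAt_timeVector M a hz (n := 0)).continuousAt.add
      (hc.smul (kerrEscapeCont_continuousAt_radiusGradVector M a hz))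
  have hY₂c : ∀ z, Kerr.rPlus M a < Kerr.radius a z → ContinuousAt Y₂ z := fun z hzext ↦
    (Kerr.contDiffAt_timeVector M a (hext0 z hzext) (n := 0)).continuousAt.neg
  -- the rate `ν = inf 2H`
  obtain ⟨ν, hν, hνle⟩ : ∃ ν : ℝ, 0 < ν ∧ ∀ z, r_lo ≤ Kerr.radius a z → Kerr.radius a z ≤ r_hi →
      ν ≤ 2 * Kerr.scalarH M a z := by
    refine kerrEscapeCont_exists_pos_le hlo0 (fun z hz₁ _ ↦ ?_) (fun z t ↦ ?_) (fun z hz₁ _ ↦ ?_)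
    · exact continuousAt_const.mul (Kerr.contDiffAt_scalarH M a (hpos z hz₁) (n := 0)).continuousAt
    · rw [Kerr.scalarH_add_smul_basisVector_zero]
    · exact mul_pos two_pos (kerrEscapeCont_scalarH_pos hM (hpos z hz₁))
  -- the bounds `L₁ = sup ‖Y₁‖`, `L₂ = sup ‖Y₂‖`
  obtain ⟨L₁, hL₁, hL₁le⟩ : ∃ L₁ : ℝ, 0 < L₁ ∧ ∀ z, r_lo ≤ Kerr.radius a z →
      Kerr.radius a z ≤ r_hi → ‖Y₁ z‖ ≤ L₁ := by
    refine kerrEscapeCont_exists_norm_le hlo0 (fun z hz₁ _ ↦ hY₁c z (hext z hz₁)) (fun z t ↦ ?_)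
    simp only [hY₁def, hΔdef, Kerr.timeVector_add_smul_basisVector_zero,
      Kerr.radius_add_time_smul_basisVector, kerrEscapeCont_radiusGradVector_add_time]
  obtain ⟨L₂, hL₂, hL₂le⟩ : ∃ L₂ : ℝ, 0 < L₂ ∧ ∀ z, r_lo ≤ Kerr.radius a z →
      Kerr.radius a z ≤ r_hi → ‖Y₂ z‖ ≤ L₂ := by
    refine kerrEscapeCont_exists_norm_le hlo0 (fun z hz₁ _ ↦ hY₂c z (hext z hz₁)) (fun z t ↦ ?_)
    simp only [hY₂def, Kerr.timeVector_add_smul_basisVector_zero]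
  refine ⟨1, ν, max L₁ L₂, one_pos, hν, lt_max_of_lt_left hL₁, Y₁, Y₂,
    fun z hz ↦ (hY₁c z hz).continuousWithinAt, fun z hz ↦ (hY₂c z hz).continuousWithinAt,
    fun z hz₁ hz₂ ↦ ?_⟩
  have hz : 0 < Kerr.radius a z := hpos z hz₁
  have hΔz : Δ z ≠ 0 := (hΔpos z (hext z hz₁)).ne'
  have hH : 0 ≤ Kerr.scalarH M a z := Kerr.scalarH_nonneg hM.le a z
  have hc : 0 ≤ 4 * M * Kerr.radius a z / Δ z :=
    div_nonneg (by positivity) (hΔpos z (hext z hz₁)).le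
  refine ⟨(hL₁le z hz₁ hz₂).trans (le_max_left _ _), (hL₂le z hz₁ hz₂).trans (le_max_right _ _),
    ?_, ?_, ?_, ?_, ?_⟩
  · -- `g(Y₁, Y₁) = −1 − 2H ≤ −1`
    have h := kerrEscapeCont_bilin_Y₁_Y₁ hz hΔz
    simp only [hY₁def, hΔdef]
    rw [h]
    linarith
  · -- `g(Y₂, Y₂) = −1 − 2H ≤ −1`
    simp only [hY₂def]
    rw [kerrEscapeCont_bilin_Y₂_Y₂ hz]
    linarith
  · -- `g(Y₁, Y₂) = 1 + 2H + (4Mr/Δ) 2H ≥ 1`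
    simp only [hY₁def, hY₂def, hΔdef]
    rw [kerrEscapeCont_bilin_Y₁_Y₂ hz]
    nlinarith
  · -- `dr(Y₁) = 2H ≥ ν`
    have h := kerrEscapeCont_dr_Y₁ hz hΔz
    simp only [hY₁def, hΔdef]
    rw [h]
    exact hνle z hz₁ hz₂
  · -- `dr(Y₂) = 2H ≥ ν`
    simp only [hY₂def]
    rw [kerrEscapeCont_dr_Y₂ hz]
    exact hνle z hz₁ hz₂

end Summit.FinalStateConjecture.FinalStateConjecture.Theorems

end
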